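import Summits.QuantumFields.QCD.Theses.HeatSlicedQuarks
import Summits.QuantumFields.QCD.Theorems.HeatSlicedQuarksInterleavedHeatSliceFlowStubCoveringPeriodization
import Summits.QuantumFields.QCD.Theorems.HeatSlicedQuarksTracedQuadraticParametrixTracedCoreAssemblyImageSum
import Summits.QuantumFields.QCD.Theorems.SmallFieldUltracontractivity.Negative.LoadBearing

/-!
# Stub `stub_tracedCoreAssembly` of line `Sketch`
(crux `Summit.QuantumFields.QCD.Theses.HeatSlicedQuarks.TracedQuadraticParametrix`, item stmt-QuantumFields-17985)

**Core-regime assembly of the traced quadratic parametrix**: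
`DaviesGaffneyWilson → InteriorTracedBound → TracedCoreBound`, written out.  With
`H_V = D_W(V)ᴴ D_W(V)` (Wilson parameter `r = 1`), `K_V(t) = exp(-t H_V)` on the discrete four-torus
`T_L` and the colour–spin trace `Φ_U(t)(x) = Σ_{aα} Re K_U(t)((x,a,α),(x,a,α)) − Σ_{aα} Re K_1(t)(…)`,
the claim is: under GLOBAL `(ε/r²)²`-smallness of the plaquette deficits of `U`, for `1 ≤ t ≤ r²` in
the core regime `t (1 + log t)² ≤ L²`, `|Φ_U(t)(x)| ≤ C (ε/r²)²` on EVERY torus `L ≥ r`, given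
(1) the `U`-uniform Davies–Gaffney bound `|K_U(t)((x,a,α),(y,b,β))| ≤ C_dg e^{-c d²/(t+d)}` and
(2) the interior traced bound `|Φ_U(t)(x)| ≤ C_int (ε/r²)²` on tori of side `L ≥ A r²/ε`, `ε ≤ ε₀`.

## Proof (bookkeeping; pattern `stub_periodizationAssembly`)

* Constants: `ε := ε₀`, `C := C_int + 24 (max C_dg 0) C_img / ε₀²`.
* Cover: choose `N ≥ 1` with `A r²/ε₀ ≤ N` and pass to the `N⁴`-sheeted cover `π : T_{NL} → T_L`
  (coordinatewise `ZMod.castHom`); lift `x` to `x̃` (`exists_lift`).  The landed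
  `stub_coveringPeriodization`, for `U` and for `U ≡ 1`, at `y = π x̃`, `b = a`, `β = α`, summed over
  `a, α` with real parts taken, writes both traces on `T_L` as fibre sums
  `Σ_{π z̃ = π x̃} Σ_{aα} Re K((x̃,a,α),(z̃,a,α))` of the kernels of the pulled-back fields on `T_{NL}`
  (`traced_fibre_bound`); the pull-back of the constant field is the constant field.
* The pulled-back field has the same plaquette holonomies (`plaquetteHolonomy_pull`), hence the same
  global smallness (`small_pull`).
* Fibre term `z̃ = x̃`: hypothesis (2) on `T_{NL}` (`r ≤ L ≤ NL`, `A r²/ε₀ ≤ N ≤ NL`) gives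
  `C_int (ε₀/r²)²`.
* Deck images `z̃ ≠ x̃`: each of the `12` traced entries of both kernels is bounded by hypothesis (1)
  on the cover (`m ∈ [-1/2,1] ⊂ [-1,1]`, `t ≥ 1 ≥ 0`), so an image contributes
  `≤ 24 (max C_dg 0) e^{-c d(x̃,z̃)²/(t+d)}`, and the landed exponential image sum `stub_imageSumDG`
  gives `Σ_{images} e^{-c d²/(t+d)} ≤ C_img / L⁴` in the regime `1 ≤ t`, `t(1+log t)² ≤ L²`.
* Finally `1/L⁴ ≤ 1/r⁴ = ε₀⁻² (ε₀/r²)²` since `r ≤ L`.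

Leans on: `stub_coveringPeriodization` (landed, p99754), `stub_imageSumDG` (landed, p136435), the
tree definitions `plaquetteHolonomy`, `Site.shift`, `SU3`, `freeCfg`, and Mathlib (`ZMod.castHom`,
`Finset` algebra).  The hypothesis `DaviesGaffneyWilson` is the route definition, taken by name.
No named facts.
-/

namespace Summit.QuantumFields.QCD.Cruxes.TracedQuadraticParametrix.Sketch

open Literature.MathematicalPhysics.QuantumLattice Literature.MathematicalPhysics.QuantumFieldTheory
  Literature.Probability.LatticeModels
open Summit.QuantumFields.QCD.Theses.HeatSlicedQuarks
open Summit.QuantumFields.QCD.Cruxes.InterleavedHeatSliceFlow.Sketch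
open Summit.QuantumFields.QCD.Theorems.SmallFieldUltracontractivity.Negative
open scoped Matrix ComplexConjugate

/-! ### Real-number bookkeeping: the traced fibre split -/

/-- A `3 × 4` block of complex entries of norm `≤ B` has traced real part of absolute value `≤ 12 B`. -/
private theorem abs_sum_re_le {K : Fin 3 → Fin 4 → ℂ} {B : ℝ} (h : ∀ a α, ‖K a α‖ ≤ B) :
    |∑ a : Fin 3, ∑ α : Fin 4, (K a α).re| ≤ 12 * B :=
  calc |∑ a : Fin 3, ∑ α : Fin 4, (K a α).re|
      ≤ ∑ a : Fin 3, |∑ α : Fin 4, (K a α).re| := Finset.abs_sum_le_sum_abs _ _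
    _ ≤ ∑ a : Fin 3, ∑ α : Fin 4, |(K a α).re| :=
        Finset.sum_le_sum fun a _ => Finset.abs_sum_le_sum_abs _ _
    _ ≤ ∑ _a : Fin 3, ∑ _α : Fin 4, B :=
        Finset.sum_le_sum fun a _ => Finset.sum_le_sum fun α _ =>
          (Complex.abs_re_le_norm _).trans (h a α)
    _ = 12 * B := by
        simp only [Finset.sum_const, Finset.card_univ, Fintype.card_fin, nsmul_eq_mul, Nat.cast_ofNat]
        ring

/-- The traced fibre split: if every traced base entry is a fibre sum of cover entries
(`KU a α = Σ_{z ∈ s} F z a α`, `K1 a α = Σ_{z ∈ s} G z a α`, periodization), `z₀ ∈ s` (the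
diagonal lift), the images `z ≠ z₀` obey `‖F z a α‖, ‖G z a α‖ ≤ M w z` with `Σ_{z ≠ z₀} w z ≤ B₁`,
and the traced diagonal term obeys `|Σ Re F z₀ − Σ Re G z₀| ≤ B₀`, then
`|Σ_{aα} Re KU − Σ_{aα} Re K1| ≤ B₀ + 24 M B₁`. -/
private theorem traced_fibre_bound {ι : Type*} [DecidableEq ι] {s : Finset ι} {z₀ : ι}
    (hz₀ : z₀ ∈ s) {KU K1 : Fin 3 → Fin 4 → ℂ} {F G : ι → Fin 3 → Fin 4 → ℂ}
    (hU : ∀ a α, KU a α = ∑ z ∈ s, F z a α) (h1 : ∀ a α, K1 a α = ∑ z ∈ s, G z a α)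
    {M : ℝ} {w : ι → ℝ} {B₀ B₁ : ℝ} (hM : 0 ≤ M)
    (hF : ∀ z ∈ s.erase z₀, ∀ a α, ‖F z a α‖ ≤ M * w z)
    (hG : ∀ z ∈ s.erase z₀, ∀ a α, ‖G z a α‖ ≤ M * w z)
    (h0 : |(∑ a : Fin 3, ∑ α : Fin 4, (F z₀ a α).re) -
        (∑ a : Fin 3, ∑ α : Fin 4, (G z₀ a α).re)| ≤ B₀)
    (hsum : ∑ z ∈ s.erase z₀, w z ≤ B₁) :
    |(∑ a : Fin 3, ∑ α : Fin 4, (KU a α).re) - (∑ a : Fin 3, ∑ α : Fin 4, (K1 a α).re)| ≤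
      B₀ + 24 * M * B₁ := by
  -- both traces are fibre sums of traced cover entries
  have swap : ∀ (E : ι → Fin 3 → Fin 4 → ℂ) (K : Fin 3 → Fin 4 → ℂ),
      (∀ a α, K a α = ∑ z ∈ s, E z a α) →
      (∑ a : Fin 3, ∑ α : Fin 4, (K a α).re) =
        ∑ z ∈ s, ∑ a : Fin 3, ∑ α : Fin 4, (E z a α).re := by
    intro E K hK
    calc (∑ a : Fin 3, ∑ α : Fin 4, (K a α).re)
        = ∑ a : Fin 3, ∑ α : Fin 4, ∑ z ∈ s, (E z a α).re := by
          refine Finset.sum_congr rfl fun a _ => Finset.sum_congr rfl fun α _ => ?_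
          rw [hK, Complex.re_sum]
      _ = ∑ a : Fin 3, ∑ z ∈ s, ∑ α : Fin 4, (E z a α).re :=
          Finset.sum_congr rfl fun a _ => Finset.sum_comm
      _ = _ := Finset.sum_comm
  rw [swap F KU hU, swap G K1 h1, ← Finset.sum_sub_distrib, ← Finset.add_sum_erase s _ hz₀]
  refine (abs_add_le _ _).trans (add_le_add h0 ((Finset.abs_sum_le_sum_abs _ _).trans ?_))
  calc ∑ z ∈ s.erase z₀, |(∑ a : Fin 3, ∑ α : Fin 4, (F z a α).re) -
          ∑ a : Fin 3, ∑ α : Fin 4, (G z a α).re|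
      ≤ ∑ z ∈ s.erase z₀, (12 * (M * w z) + 12 * (M * w z)) := by
        refine Finset.sum_le_sum fun z hz => (abs_sub _ _).trans ?_
        exact add_le_add (abs_sum_re_le (hF z hz)) (abs_sum_re_le (hG z hz))
    _ = 24 * M * ∑ z ∈ s.erase z₀, w z := by
        rw [Finset.mul_sum]
        exact Finset.sum_congr rfl fun z _ => by ring
    _ ≤ 24 * M * B₁ := mul_le_mul_of_nonneg_left hsum (by positivity)

/-! ### The cover `T_{NL} → T_L`
(adapted from Summits/QuantumFields/QCD/Theorems/HeatSlicedQuarksInterleavedHeatSliceFlowStubPeriodizationAssembly.lean) -/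

/-- Every site of the base torus lifts to the cover: `π x̃ = x` for `x̃ μ := (x μ).val`. -/
private theorem exists_lift (N L : ℕ) [NeZero L] (x : TorusSite 4 L) :
    ∃ z : TorusSite 4 (N * L), (fun μ => ZMod.castHom (dvd_mul_left L N) (ZMod L) (z μ)) = x :=
  -- adapted from …StubPeriodizationAssembly.lean
  ⟨fun μ => ((x μ).val : ZMod (N * L)), funext fun μ =>
    (map_natCast _ (x μ).val).trans (ZMod.natCast_zmod_val (x μ))⟩

/-- The coordinatewise reduction `π : (ℤ/NLℤ)⁴ → (ℤ/Lℤ)⁴` commutes with the unit shifts: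
`π (x + μ̂) = π x + μ̂`. -/
private theorem castHom_shift' (N L : ℕ) (x : TorusSite 4 (N * L)) (μ : Fin 4) :
    (fun ν => ZMod.castHom (dvd_mul_left L N) (ZMod L) (Site.shift x μ ν)) =
      Site.shift (fun ν => ZMod.castHom (dvd_mul_left L N) (ZMod L) (x ν)) μ := by
  -- adapted from …StubPeriodizationAssembly.lean
  funext ν
  simp only [Literature.MathematicalPhysics.QuantumFieldTheory.Site.shift, Pi.add_apply, map_add,
    Pi.single_apply]
  split_ifs <;> simp

/-- Plaquette holonomies of a pulled-back configuration are the pulled-back plaquette holonomies: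
`(U ∘ π)_p(ỹ; μ, ν) = U_p(π ỹ; μ, ν)` whenever `π` commutes with the unit shifts. -/
private theorem plaquetteHolonomy_pull {G : Type*} [Group G] {L L' : ℕ}
    (π : TorusSite 4 L' → TorusSite 4 L) (hπ : ∀ x μ, π (Site.shift x μ) = Site.shift (π x) μ)
    (U : GaugeConfig 4 L G) (y : TorusSite 4 L') (μ ν : Fin 4) :
    plaquetteHolonomy (fun e : Edge 4 L' => U (π e.1, e.2)) y μ ν =
      plaquetteHolonomy U (π y) μ ν := by
  -- adapted from …StubPeriodizationAssembly.lean
  simp only [plaquetteHolonomy, hπ]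

/-- Global plaquette smallness lifts to the cover: the pulled-back field `U ∘ π` on `T_{NL}` has
the same deficit bound as `U` on `T_L`. -/
private theorem small_pull (N L : ℕ) (U : GaugeConfig 4 L SU3)
    {δ : ℝ} (h : ∀ (y : TorusSite 4 L) (μ ν : Fin 4),
      3 - ((fundamentalRep (Fin 3)) (plaquetteHolonomy U y μ ν)).trace.re ≤ δ)
    (y : TorusSite 4 (N * L)) (μ ν : Fin 4) :
    3 - ((fundamentalRep (Fin 3)) (plaquetteHolonomy
      (fun e : Edge 4 (N * L) =>
        U ((fun μ => ZMod.castHom (dvd_mul_left L N) (ZMod L) (e.1 μ)), e.2)) y μ ν)).trace.re ≤ δ := by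
  -- adapted from …StubPeriodizationAssembly.lean
  have key := plaquetteHolonomy_pull
    (fun (z : TorusSite 4 (N * L)) μ => ZMod.castHom (dvd_mul_left L N) (ZMod L) (z μ))
    (castHom_shift' N L) U y μ ν
  rw [key]
  exact h _ μ ν

/-- The deck images of `x̃` in its own fibre: removing `x̃` from the fibre `π⁻¹(π x̃)` leaves the
index set of the image sum `stub_imageSumDG`. -/
private theorem fibre_erase_eq (N L : ℕ) [NeZero (N * L)] (x : TorusSite 4 (N * L)) :
    (Finset.univ.filter fun z : TorusSite 4 (N * L) =>
        (fun μ => ZMod.castHom (dvd_mul_left L N) (ZMod L) (z μ)) =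
          fun μ => ZMod.castHom (dvd_mul_left L N) (ZMod L) (x μ)).erase x =
      Finset.univ.filter fun z : TorusSite 4 (N * L) =>
        (fun μ => ZMod.castHom (dvd_mul_left L N) (ZMod L) (z μ)) =
          (fun μ => ZMod.castHom (dvd_mul_left L N) (ZMod L) (x μ)) ∧ z ≠ x := by
  -- adapted from …StubPeriodizationAssembly.lean
  ext z
  simp only [Finset.mem_erase, Finset.mem_filter, Finset.mem_univ, true_and]
  exact and_comm

/-! ### The stub -/

/-- **Stub `stub_tracedCoreAssembly`** (M/L glue; worker) of line `Sketch`: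
`DaviesGaffneyWilson → InteriorTracedBound → TracedCoreBound`, written out (the two skeleton
definitions unfolded verbatim).  With `ε := ε₀` and `C := C_int + 24 (max C_dg 0) C_img/ε₀²`: choose
`N ≥ 1` with `A r²/ε₀ ≤ N`, lift `x` to `x̃ ∈ T_{NL}`; `stub_coveringPeriodization` for `U` and for
`U ≡ 1` writes `Φ^{T_L}_U(t)(x)` as the fibre sum of `Σ_{aα} Re [K_Ũ − K_1]((x̃,a,α),(z̃,a,α))` over
`π z̃ = x`; the pulled-back field `Ũ = U ∘ π` has the same plaquette deficits; the term `z̃ = x̃` is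
`InteriorTracedBound` on `T_{NL}` (`A r²/ε₀ ≤ N ≤ NL`); the images are bounded entrywise by
`DaviesGaffneyWilson` on the cover (both kernels, `12` entries each) and summed by the landed
`stub_imageSumDG`: `Σ_{images} e^{-c d²/(t+d)} ≤ C_img/L⁴ ≤ C_img ε₀⁻² (ε₀/r²)²` (`r ≤ L`).
Leans on: `stub_coveringPeriodization`, `stub_imageSumDG` (landed), `plaquetteHolonomy`,
`Site.shift`, Mathlib. -/
theorem stub_tracedCoreAssembly :
    DaviesGaffneyWilson →
    (∃ ε₀ : ℝ, 0 < ε₀ ∧ ∃ A C : ℝ, ∀ (L : ℕ) [NeZero L]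
      (U : GaugeConfig 4 L (SU3)) (m : ℝ), m ∈ Set.Icc (-(1 / 2 : ℝ)) 1 →
      ∀ (r : ℕ), 1 ≤ r → r ≤ L → ∀ (ε : ℝ), 0 < ε → ε ≤ ε₀ →
      (∀ (y : TorusSite 4 L) (μ ν : Fin 4),
        3 - ((fundamentalRep (Fin 3)) (plaquetteHolonomy U y μ ν)).trace.re ≤ (ε / (r : ℝ) ^ 2) ^ 2) →
      A * (r : ℝ) ^ 2 / ε ≤ (L : ℝ) →
      ∀ (t : ℝ), 1 ≤ t → t ≤ (r : ℝ) ^ 2 → ∀ (x : TorusSite 4 L),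
        |(∑ a : Fin 3, ∑ α : Fin 4, ((NormedSpace.exp (-(t : ℂ) •
              ((wilsonDirac (fundamentalRep (Fin 3)) U m 1)ᴴ * wilsonDirac (fundamentalRep (Fin 3)) U m 1)))
              (x, a, α) (x, a, α)).re) -
          (∑ a : Fin 3, ∑ α : Fin 4, ((NormedSpace.exp (-(t : ℂ) •
              ((wilsonDirac (fundamentalRep (Fin 3))
                  (freeCfg L) m 1)ᴴ *
                wilsonDirac (fundamentalRep (Fin 3))
                  (freeCfg L) m 1)))
              (x, a, α) (x, a, α)).re)| ≤
          C * (ε / (r : ℝ) ^ 2) ^ 2) →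
    ∃ ε : ℝ, 0 < ε ∧ ∃ C : ℝ, ∀ (L : ℕ) [NeZero L]
      (U : GaugeConfig 4 L (SU3)) (m : ℝ), m ∈ Set.Icc (-(1 / 2 : ℝ)) 1 →
      ∀ (r : ℕ), 1 ≤ r → r ≤ L →
      (∀ (y : TorusSite 4 L) (μ ν : Fin 4),
        3 - ((fundamentalRep (Fin 3)) (plaquetteHolonomy U y μ ν)).trace.re ≤ (ε / (r : ℝ) ^ 2) ^ 2) →
      ∀ (t : ℝ), 1 ≤ t → t ≤ (r : ℝ) ^ 2 → t * (1 + Real.log t) ^ 2 ≤ (L : ℝ) ^ 2 → ∀ (x : TorusSite 4 L),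
        |(∑ a : Fin 3, ∑ α : Fin 4, ((NormedSpace.exp (-(t : ℂ) •
              ((wilsonDirac (fundamentalRep (Fin 3)) U m 1)ᴴ * wilsonDirac (fundamentalRep (Fin 3)) U m 1)))
              (x, a, α) (x, a, α)).re) -
          (∑ a : Fin 3, ∑ α : Fin 4, ((NormedSpace.exp (-(t : ℂ) •
              ((wilsonDirac (fundamentalRep (Fin 3))
                  (freeCfg L) m 1)ᴴ *
                wilsonDirac (fundamentalRep (Fin 3))
                  (freeCfg L) m 1)))
              (x, a, α) (x, a, α)).re)| ≤
          C * (ε / (r : ℝ) ^ 2) ^ 2 := by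
  rintro ⟨C₁, c, hc, hDG⟩ ⟨ε₀, hε₀, A, C₃, hInt⟩
  obtain ⟨C₂, hC₂0, hImg⟩ := stub_imageSumDG c hc
  refine ⟨ε₀, hε₀, C₃ + 24 * max C₁ 0 * C₂ / ε₀ ^ 2, ?_⟩
  intro L _ U m hm r hr hrL hsmall t ht htr hreg x
  -- positivity bookkeeping
  have hr0 : (0 : ℝ) < (r : ℝ) := by exact_mod_cast Nat.lt_of_lt_of_le Nat.zero_lt_one hr
  have ht0 : (0 : ℝ) ≤ t := zero_le_one.trans ht
  have hL1 : (1 : ℝ) ≤ (L : ℝ) := by exact_mod_cast hr.trans hrL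
  have hrL4 : (r : ℝ) ^ 4 ≤ (L : ℝ) ^ 4 := pow_le_pow_left₀ hr0.le (by exact_mod_cast hrL) 4
  have hm' : m ∈ Set.Icc (-1 : ℝ) 1 := ⟨by linarith [hm.1], hm.2⟩
  -- the cover degree `N ≥ 1` with `A r²/ε₀ ≤ N ≤ N L`
  obtain ⟨N, hN, hAN⟩ : ∃ N : ℕ, 0 < N ∧ A * (r : ℝ) ^ 2 / ε₀ ≤ (N : ℝ) :=
    ⟨⌈A * (r : ℝ) ^ 2 / ε₀⌉₊ + 1, Nat.succ_pos _,
      (Nat.le_ceil _).trans (Nat.cast_le.2 (Nat.le_succ _))⟩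
  haveI : NeZero (N * L) := ⟨Nat.mul_ne_zero hN.ne' (NeZero.ne L)⟩
  have hrNL : r ≤ N * L := hrL.trans (Nat.le_mul_of_pos_left L hN)
  have hANL : A * (r : ℝ) ^ 2 / ε₀ ≤ ((N * L : ℕ) : ℝ) := by
    rw [Nat.cast_mul]
    exact hAN.trans (le_mul_of_one_le_right (Nat.cast_nonneg N) hL1)
  -- lift `x` to the cover: from now on `x = π xt`
  obtain ⟨xt, rfl⟩ := exists_lift N L x
  have hmem : xt ∈ Finset.univ.filter (fun z : TorusSite 4 (N * L) =>
      (fun μ => ZMod.castHom (dvd_mul_left L N) (ZMod L) (z μ)) =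
        fun μ => ZMod.castHom (dvd_mul_left L N) (ZMod L) (xt μ)) :=
    Finset.mem_filter.2 ⟨Finset.mem_univ _, rfl⟩
  -- the image sum, in the regime
  have hI := hImg N L xt t ht hreg
  rw [← fibre_erase_eq N L xt] at hI
  -- periodize both traces, split the fibre, bound the diagonal lift and the images
  refine (traced_fibre_bound hmem
    (fun a α => stub_coveringPeriodization N L U m t xt
      (fun μ => ZMod.castHom (dvd_mul_left L N) (ZMod L) (xt μ)) a a α α)
    (fun a α => stub_coveringPeriodization N L (freeCfg L) m t xt
      (fun μ => ZMod.castHom (dvd_mul_left L N) (ZMod L) (xt μ)) a a α α)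
    (le_max_right C₁ 0)
    (fun z _ a α => (hDG (N * L) _ m hm' t ht0 xt z a a α α).trans
      (mul_le_mul_of_nonneg_right (le_max_left C₁ 0) (Real.exp_pos _).le))
    (fun z _ a α => (hDG (N * L) _ m hm' t ht0 xt z a a α α).trans
      (mul_le_mul_of_nonneg_right (le_max_left C₁ 0) (Real.exp_pos _).le))
    (hInt (N * L) _ m hm r hr hrNL ε₀ hε₀ le_rfl (small_pull N L U hsmall) hANL t ht htr xt)
    hI).trans ?_
  -- constants algebra: `1/L⁴ ≤ 1/r⁴ = ε₀⁻² (ε₀/r²)²`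
  have hkey : C₂ / (L : ℝ) ^ 4 ≤ C₂ / ε₀ ^ 2 * (ε₀ / (r : ℝ) ^ 2) ^ 2 :=
    calc C₂ / (L : ℝ) ^ 4 ≤ C₂ / (r : ℝ) ^ 4 :=
          div_le_div_of_nonneg_left hC₂0 (by positivity) hrL4
      _ = C₂ / ε₀ ^ 2 * (ε₀ / (r : ℝ) ^ 2) ^ 2 := by
          field_simp
  calc C₃ * (ε₀ / (r : ℝ) ^ 2) ^ 2 + 24 * max C₁ 0 * (C₂ / (L : ℝ) ^ 4)
      ≤ C₃ * (ε₀ / (r : ℝ) ^ 2) ^ 2 + 24 * max C₁ 0 * (C₂ / ε₀ ^ 2 * (ε₀ / (r : ℝ) ^ 2) ^ 2) := by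
        gcongr
    _ = (C₃ + 24 * max C₁ 0 * C₂ / ε₀ ^ 2) * (ε₀ / (r : ℝ) ^ 2) ^ 2 := by ring

end Summit.QuantumFields.QCD.Cruxes.TracedQuadraticParametrix.Sketch
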